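import Literature.MathematicalPhysics.QuantumLattice.HubbardHalfFilledPseudospinSinglet
import Literature.MathematicalPhysics.QuantumLattice.FermionHopAmplitudeBound
import HarnessLib

/-!
# Pseudospin isotropy at half filling: charge, density and s-wave pair correlators of THE Hubbard ground state

Topic `Literature/MathematicalPhysics/QuantumLattice` (family `hubbard`). Everything here is PROVED — no
definitions, no named facts, no `sorry`. It continues `HubbardHalfFilledPseudospinSinglet` (every half-filled
ground state of the repulsive Hubbard model on a connected balanced bipartite graph is a pseudospin singlet,
`η_ε ψ = η†_ε ψ = 0`: Yang–Zhang, Lieb) by drawing the consequences of the `η`-`SU(2)` invariance for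
TWO-POINT functions, and adds the Lieb–Loss–McCann uniform density theorem for these ground states.

Notation: `Δ†_x = c†_{x↑} c†_{x↓}`, `Δ_y = c_{y↓} c_{y↑}`, `n_x = n_{x↑} + n_{x↓}` (`numberOp x 0 + numberOp x 1`),
`D_x = n_{x↑} n_{x↓}`, `D̂ = Σ_x D_x`, a staggering `ε : Λ → ℤˣ`, `η_ε = Σ_x ε_x Δ_x` (`etaLower ε`),
`η†_ε = etaRaise ε`; `expect A φ = ⟨φ, A φ⟩`.

## What is proved

* §2 the commutator `[η†_ε, (n_x - 1) Δ_y] = -2 ε_x Δ†_x Δ_y + ε_y (n_x - 1)(n_y - 1)` for `x ≠ y`, as a vector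
  identity (`etaRaise_commutator_chargeDev_pairAnnihilation`);
* §3 **pseudospin isotropy**: if `η_ε ψ = η†_ε ψ = 0` then for all `x ≠ y`
  `⟨ψ, (n_x - 1)(n_y - 1) ψ⟩ = 2 ε_x ε_y ⟨ψ, Δ†_x Δ_y ψ⟩` (`expect_chargeDev_mul_chargeDev_eq_of_eta_mulVec_eq_zero`)
  — the `zz` and `+-` components of the pseudospin–pseudospin correlator of a `J = 0` vector agree (Zhang; in
  Xiang–Wu's words, eqs. (13.51)–(13.52): at half filling the CDW and s-wave pairing correlations are degenerate);
* §4 Cauchy–Schwarz ceilings valid for every vector: `|⟨φ, Δ†_x Δ_y φ⟩| ≤ (Re⟨φ, D_x φ⟩ + Re⟨φ, D_y φ⟩)/2`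
  (`norm_expect_pairCreation_mul_pairAnnihilation_le`), hence `|⟨ψ, (n_x - 1)(n_y - 1) ψ⟩| ≤ Re⟨D_x⟩ + Re⟨D_y⟩`
  for `x ≠ y` in `η`-singlets (`norm_expect_chargeDev_mul_chargeDev_le_of_eta_mulVec_eq_zero`);
* §5 the same for every half-filled ground state of `hamiltonian G t U`, `G` connected bipartite with `|A| = |B|`,
  `t ≠ 0`, `U > 0` (`expect_chargeDev_mul_chargeDev_eq_of_groundState`, `…_of_isGroundState`,
  `norm_expect_chargeDev_mul_chargeDev_le_of_isGroundState`);
* §5b the **uniform density theorem** (Lieb–Loss–McCann, Theorem, eq. (5)) for these ground states: the charge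
  part `⟨ψ, n_x ψ⟩ = ‖ψ‖²` at every site already for every half-filled (`N = |Λ|`) pseudospin singlet
  (`expect_siteNumber_eq_norm_sq_of_eta_mulVec_eq_zero`: sum the isotropy identity over `y ≠ x`), the spin part
  `⟨n_{x↑}⟩ = ⟨n_{x↓}⟩` for every spin singlet (`expect_numberOp_up_eq_down_of_spin_singlet`), together
  `⟨ψ, n_{xσ} ψ⟩ = ½ ‖ψ‖²` (`expect_numberOp_eq_half_of_groundState`, via Lieb's `S = 0`); and the connected
  density–density correlator `⟨ψ, n_x n_y ψ⟩ - ‖ψ‖² = 2 ε_x ε_y ⟨ψ, Δ†_x Δ_y ψ⟩`, `x ≠ y`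
  (`expect_siteNumber_mul_siteNumber_sub_eq_of_groundState`);
* §6 the even square torus `(ℤ/Lℤ)²` with Yang's staggering `ε_x = (-1)^{x₁+x₂}` (`torusStagger`): for every
  vector `φ` and displacement `r`, `|Σ_x ⟨φ, Δ†_x Δ_{x+r} φ⟩| ≤ Re⟨φ, D̂ φ⟩` (`norm_sum_expect_pair_translate_le`);
  for every half-filled ground state (`L` even, `t ≠ 0`, `U > 0`) and `r ≠ 0`,
  `Σ_x ⟨(n_x - 1)(n_{x+r} - 1)⟩ = 2 ε_r Σ_x ⟨Δ†_x Δ_{x+r}⟩`, both sums bounded in norm by `2 Re⟨D̂⟩` resp. `Re⟨D̂⟩`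
  (`hubbardTorus_sum_expect_chargeDev_translate_eq`, `hubbardTorus_norm_sum_expect_chargeDev_translate_le`),
  `⟨n_{xσ}⟩ = ½ ‖ψ‖²` (`hubbardTorus_expect_numberOp_eq_half`) and
  `Σ_x ⟨n_x n_{x+r}⟩ - L² ‖ψ‖² = 2 ε_r Σ_x ⟨Δ†_x Δ_{x+r}⟩`, `|…| ≤ 2 Re⟨D̂⟩`
  (`hubbardTorus_sum_expect_siteNumber_translate`).

## Use and honest scope

A certified bracket on the ground-state double occupancy `⟨D̂⟩` (such rows exist for the `4×4` torus under
`Summits/HubbardSuperconductivity/HubbardLadder/`) is therefore at once a certified CEILING on the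
translation-averaged on-site (s-wave) pair correlator and on the connected density–density correlator at EVERY
fixed distance `r ≠ 0`, and the two are tied by an exact identity. The ceilings are `O(⟨D̂⟩/|Λ|)` per site and carry
no decay information; everything is restricted to half filling (`N = |Λ|`) and bipartite hopping (`t' = 0`), where
the `η`-symmetry is exact. Nothing here bears on d-wave pairing or on the doped model.

References: S.-C. Zhang, Phys. Rev. Lett. 65 (1990) 120 [Zhang1990]; Phys. Rev. B 42 (1990) 1012 [ZhangPRB1990];
C. N. Yang, Phys. Rev. Lett. 63 (1989) 2144, eq. (4) [Yang1989]; C. N. Yang, S.-C. Zhang, Mod. Phys. Lett. B 4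
(1990) 759, Theorem 1 [YangZhang1990]; E. H. Lieb, Phys. Rev. Lett. 62 (1989) 1201, Theorem 2 [LiebPRL1989];
E. H. Lieb, M. Loss, R. J. McCann, J. Math. Phys. 34 (1993) 891, Theorem eq. (5) [LiebLossMccann1993];
T. Xiang, C. Wu, *D-wave Superconductivity* (CUP 2022) §13.4 eqs. (13.47)–(13.52) [XiangWu2022];
F. H. L. Essler et al., *The One-Dimensional Hubbard Model* (CUP 2005) §2.2.5 [EsslerEtAl2005];
H. Tasaki, *Physics and Mathematics of Quantum Many-Body Systems* (Springer 2020) §9.2, App. A.3 [Tasaki2020].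
-/

namespace Literature.MathematicalPhysics.QuantumLattice

open Matrix Finset

section General

variable {Λ : Type*} [LinearOrder Λ] [Fintype Λ]

/-! ### §1 CAR bookkeeping for `n_{xσ}`, `Δ†_z = c†_{z↑} c†_{z↓}`, `Δ_y = c_{y↓} c_{y↑}` -/

/-- `n_{xσ}` acts diagonally: `(n_{xσ} f)(s) = [xσ ∈ s] f(s)`. [folklore] -/
private theorem numberOp_mulVec_apply' (x : Λ) (σ : Fin 2) (f : Fock (Orb Λ)) (s : Finset (Orb Λ)) :
    (numberOp x σ *ᵥ f) s = (if orb x σ ∈ s then 1 else 0) * f s := by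
  rw [← numberAt_orb, numberAt_eq_diagonal, mulVec_diagonal]

/-- `Δ†_z` commutes with `n_{xσ}` for `z ≠ x`. Yang–Zhang, Mod. Phys. Lett. B 4 (1990) 759, eq. (5).
[folklore] -/
private theorem pairCreation_mulVec_numberOp_mulVec_of_ne {z x : Λ} (hzx : z ≠ x) (σ : Fin 2)
    (f : Fock (Orb Λ)) :
    (creation (orb z 0) * creation (orb z 1)) *ᵥ (numberOp x σ *ᵥ f) =
      numberOp x σ *ᵥ ((creation (orb z 0) * creation (orb z 1)) *ᵥ f) := by
  ext s
  have hmem : (orb x σ ∈ (s.erase (orb z 0)).erase (orb z 1)) ↔ orb x σ ∈ s := by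
    simp only [Finset.mem_erase, ne_eq, EtaPairingODLRO.orb_ne_orb_of_ne hzx.symm, not_false_eq_true,
      true_and]
  rw [EtaPairingODLRO.pairCreation_mulVec_apply, numberOp_mulVec_apply', numberOp_mulVec_apply',
    EtaPairingODLRO.pairCreation_mulVec_apply]
  by_cases h : orb z 0 ∈ s ∧ orb z 1 ∈ s
  · rw [if_pos h, if_pos h]
    by_cases hx : orb x σ ∈ s
    · rw [if_pos hx, if_pos (hmem.2 hx)]
    · rw [if_neg hx, if_neg (fun h' => hx (hmem.1 h'))]
  · rw [if_neg h, if_neg h, mul_zero]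

/-- `Δ†_x n_{xσ} = 0`: a pair cannot be created on top of an occupied orbital. Yang, PRL 63 (1989) 2144,
eq. (4). [folklore] -/
private theorem pairCreation_mulVec_numberOp_mulVec_self (x : Λ) (σ : Fin 2) (f : Fock (Orb Λ)) :
    (creation (orb x 0) * creation (orb x 1)) *ᵥ (numberOp x σ *ᵥ f) = 0 := by
  ext s
  rw [EtaPairingODLRO.pairCreation_mulVec_apply, numberOp_mulVec_apply', Pi.zero_apply]
  by_cases h : orb x 0 ∈ s ∧ orb x 1 ∈ s
  · have hx : orb x σ ∉ (s.erase (orb x 0)).erase (orb x 1) := by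
      intro hm
      rw [Finset.mem_erase, Finset.mem_erase] at hm
      obtain ⟨h1, h0, -⟩ := hm
      fin_cases σ
      · exact h0 rfl
      · exact h1 rfl
    rw [if_pos h, if_neg hx, zero_mul]
  · rw [if_neg h]

/-- `n_{xσ} Δ†_x = Δ†_x`: after creating the pair both orbitals of `x` are occupied. Yang, PRL 63 (1989)
2144, eq. (4). [folklore] -/
private theorem numberOp_mulVec_pairCreation_mulVec_self (x : Λ) (σ : Fin 2) (f : Fock (Orb Λ)) :
    numberOp x σ *ᵥ ((creation (orb x 0) * creation (orb x 1)) *ᵥ f) =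
      (creation (orb x 0) * creation (orb x 1)) *ᵥ f := by
  ext s
  rw [numberOp_mulVec_apply', EtaPairingODLRO.pairCreation_mulVec_apply]
  by_cases h : orb x 0 ∈ s ∧ orb x 1 ∈ s
  · have hx : orb x σ ∈ s := by
      fin_cases σ
      · exact h.1
      · exact h.2
    rw [if_pos h, if_pos hx, one_mul]
  · rw [if_neg h, mul_zero]

/-- The on-site commutator `Δ_y Δ†_y - Δ†_y Δ_y = 1 - n_{y↑} - n_{y↓}` as a vector identity.
Yang–Zhang, Mod. Phys. Lett. B 4 (1990) 759, Theorem 1. [folklore] -/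
private theorem pairAnnihilation_pairCreation_sub_mulVec (y : Λ) (f : Fock (Orb Λ)) :
    (annihilation (orb y 1) * annihilation (orb y 0)) *ᵥ ((creation (orb y 0) * creation (orb y 1)) *ᵥ f) -
        (creation (orb y 0) * creation (orb y 1)) *ᵥ ((annihilation (orb y 1) * annihilation (orb y 0)) *ᵥ f) =
      f - numberOp y 0 *ᵥ f - numberOp y 1 *ᵥ f := by
  ext s
  rw [Pi.sub_apply, EtaPairingODLRO.pairAnnihilation_pairCreation_self, Pi.sub_apply, Pi.sub_apply,
    numberOp_mulVec_apply', numberOp_mulVec_apply']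
  ring

/-- `Δ†_z` commutes with the charge deviation `n_x - 1 = n_{x↑} + n_{x↓} - 1` for `z ≠ x`.
Yang–Zhang, Mod. Phys. Lett. B 4 (1990) 759, eq. (5). [folklore] -/
private theorem pairCreation_mulVec_chargeDev_mulVec_of_ne {z x : Λ} (hzx : z ≠ x) (f : Fock (Orb Λ)) :
    (creation (orb z 0) * creation (orb z 1)) *ᵥ ((numberOp x 0 + numberOp x 1 - 1) *ᵥ f) =
      (numberOp x 0 + numberOp x 1 - 1) *ᵥ ((creation (orb z 0) * creation (orb z 1)) *ᵥ f) := by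
  rw [sub_mulVec, add_mulVec, one_mulVec, sub_mulVec, add_mulVec, one_mulVec, mulVec_sub, mulVec_add,
    pairCreation_mulVec_numberOp_mulVec_of_ne hzx, pairCreation_mulVec_numberOp_mulVec_of_ne hzx]

/-- `Δ†_x (n_x - 1) = -Δ†_x`. Yang, PRL 63 (1989) 2144, eq. (4). [folklore] -/
private theorem pairCreation_mulVec_chargeDev_mulVec_self (x : Λ) (f : Fock (Orb Λ)) :
    (creation (orb x 0) * creation (orb x 1)) *ᵥ ((numberOp x 0 + numberOp x 1 - 1) *ᵥ f) =
      -((creation (orb x 0) * creation (orb x 1)) *ᵥ f) := by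
  rw [sub_mulVec, add_mulVec, one_mulVec, mulVec_sub, mulVec_add,
    pairCreation_mulVec_numberOp_mulVec_self, pairCreation_mulVec_numberOp_mulVec_self, zero_add, zero_sub]

/-- `(n_x - 1) Δ†_x = Δ†_x`. Yang, PRL 63 (1989) 2144, eq. (4). [folklore] -/
private theorem chargeDev_mulVec_pairCreation_mulVec_self (x : Λ) (f : Fock (Orb Λ)) :
    (numberOp x 0 + numberOp x 1 - 1) *ᵥ ((creation (orb x 0) * creation (orb x 1)) *ᵥ f) =
      (creation (orb x 0) * creation (orb x 1)) *ᵥ f := by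
  rw [sub_mulVec, add_mulVec, one_mulVec, numberOp_mulVec_pairCreation_mulVec_self,
    numberOp_mulVec_pairCreation_mulVec_self]
  abel

/-! ### §2 The commutator `[η†_ε, (n_x - 1) Δ_y] = -2 ε_x Δ†_x Δ_y + ε_y (n_x - 1)(n_y - 1)` (`x ≠ y`) -/

/-- **Key commutator.** For `x ≠ y` and every Fock vector `f`,
`η†_ε (n_x - 1) Δ_y f - (n_x - 1) Δ_y η†_ε f = -2 ε_x Δ†_x Δ_y f + ε_y (n_x - 1)(n_y - 1) f`
(`η†_ε = Σ_z ε_z Δ†_z`; only `z = x` and `z = y` contribute: `[Δ†_x, n_x - 1] Δ_y = -2 Δ†_x Δ_y` after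
`(n_x - 1) Δ†_x = Δ†_x`, and `(n_x - 1) [Δ†_y, Δ_y] = (n_x - 1)(n_y - 1)`). This is the component form of
the pseudospin rotation taking the charge-density operator to the `s`-wave pairing operator.
[cite: Zhang1990] [cite: YangZhang1990, Theorem 1] -/
theorem etaRaise_commutator_chargeDev_pairAnnihilation {x y : Λ} (hxy : x ≠ y) (ε : Λ → ℤˣ)
    (f : Fock (Orb Λ)) :
    etaRaise ε *ᵥ ((numberOp x 0 + numberOp x 1 - 1) *ᵥ
        ((annihilation (orb y 1) * annihilation (orb y 0)) *ᵥ f)) -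
      (numberOp x 0 + numberOp x 1 - 1) *ᵥ
        ((annihilation (orb y 1) * annihilation (orb y 0)) *ᵥ (etaRaise ε *ᵥ f)) =
      -((2 * ((ε x : ℤ) : ℂ)) • ((creation (orb x 0) * creation (orb x 1)) *ᵥ
          ((annihilation (orb y 1) * annihilation (orb y 0)) *ᵥ f))) +
        ((ε y : ℤ) : ℂ) • ((numberOp x 0 + numberOp x 1 - 1) *ᵥ ((numberOp y 0 + numberOp y 1 - 1) *ᵥ f)) := by
  -- abbreviations
  set P : Λ → Matrix (Finset (Orb Λ)) (Finset (Orb Λ)) ℂ := fun z => creation (orb z 0) * creation (orb z 1)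
    with hP
  set Q : Matrix (Finset (Orb Λ)) (Finset (Orb Λ)) ℂ := annihilation (orb y 1) * annihilation (orb y 0) with hQ
  set Mx : Matrix (Finset (Orb Λ)) (Finset (Orb Λ)) ℂ := numberOp x 0 + numberOp x 1 - 1 with hMx
  set My : Matrix (Finset (Orb Λ)) (Finset (Orb Λ)) ℂ := numberOp y 0 + numberOp y 1 - 1 with hMy
  have hη : etaRaise ε = ∑ z, ((ε z : ℤ) : ℂ) • P z := rfl
  -- expand both `η†` into site sums
  have h1 : etaRaise ε *ᵥ (Mx *ᵥ (Q *ᵥ f)) = ∑ z, ((ε z : ℤ) : ℂ) • (P z *ᵥ (Mx *ᵥ (Q *ᵥ f))) := by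
    rw [hη, sum_mulVec]
    exact Finset.sum_congr rfl fun z _ => by rw [smul_mulVec]
  have h2 : Mx *ᵥ (Q *ᵥ (etaRaise ε *ᵥ f)) = ∑ z, ((ε z : ℤ) : ℂ) • (Mx *ᵥ (Q *ᵥ (P z *ᵥ f))) := by
    rw [hη, sum_mulVec, mulVec_sum, mulVec_sum]
    exact Finset.sum_congr rfl fun z _ => by rw [smul_mulVec, mulVec_smul, mulVec_smul]
  rw [h1, h2, ← Finset.sum_sub_distrib]
  simp_rw [← smul_sub]
  -- only `z = x` and `z = y` survive
  rw [Finset.sum_eq_add x y hxy]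
  · -- the two surviving terms
    have hx : P x *ᵥ (Mx *ᵥ (Q *ᵥ f)) - Mx *ᵥ (Q *ᵥ (P x *ᵥ f)) = -((2 : ℂ) • (P x *ᵥ (Q *ᵥ f))) := by
      rw [hMx, hQ, hP]
      dsimp only
      rw [pairCreation_mulVec_chargeDev_mulVec_self, EtaPairingODLRO.pairAnnihilation_pairCreation_comm hxy,
        chargeDev_mulVec_pairCreation_mulVec_self, two_smul]
      abel
    have hy : P y *ᵥ (Mx *ᵥ (Q *ᵥ f)) - Mx *ᵥ (Q *ᵥ (P y *ᵥ f)) = Mx *ᵥ (My *ᵥ f) := by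
      rw [hMx, hMy, hQ, hP]
      dsimp only
      rw [pairCreation_mulVec_chargeDev_mulVec_of_ne hxy.symm, ← mulVec_sub]
      congr 1
      have h5 := pairAnnihilation_pairCreation_sub_mulVec y f
      rw [sub_eq_iff_eq_add] at h5
      rw [h5, sub_mulVec, add_mulVec, one_mulVec]
      abel
    rw [hx, hy, smul_neg, smul_smul, mul_comm]
  · intro z _ hz
    rw [hMx, hQ, hP]
    dsimp only
    rw [pairCreation_mulVec_chargeDev_mulVec_of_ne hz.1,
      ← EtaPairingODLRO.pairAnnihilation_pairCreation_comm hz.2, sub_self, smul_zero]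
  · exact fun h => absurd (Finset.mem_univ x) h
  · exact fun h => absurd (Finset.mem_univ y) h

/-! ### §3 Pseudospin isotropy: `⟨(n_x - 1)(n_y - 1)⟩ = 2 ε_x ε_y ⟨Δ†_x Δ_y⟩` in every `η`-annihilated state -/

/-- `⟨ψ, η†_ε w⟩ = ⟨η_ε ψ, w⟩ = 0` when `η_ε ψ = 0`. [cite: Yang1989, eq. (4)] -/
theorem star_dotProduct_etaRaise_mulVec_eq_zero (ε : Λ → ℤˣ) {ψ : Fock (Orb Λ)}
    (hLo : etaLower ε *ᵥ ψ = 0) (w : Fock (Orb Λ)) : star ψ ⬝ᵥ (etaRaise ε *ᵥ w) = 0 := by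
  have h : star (etaLower ε *ᵥ ψ) ⬝ᵥ w = 0 := by rw [hLo, star_zero, zero_dotProduct]
  rwa [star_mulVec, etaLower, conjTranspose_conjTranspose, ← dotProduct_mulVec] at h

omit [LinearOrder Λ] [Fintype Λ] in
/-- `ε_y² = 1` in `ℂ`. [folklore] -/
private theorem stagger_cast_mul_self (ε : Λ → ℤˣ) (y : Λ) :
    ((ε y : ℤ) : ℂ) * ((ε y : ℤ) : ℂ) = 1 := by
  rw [← Int.cast_mul, ← Units.val_mul, Int.units_mul_self, Units.val_one, Int.cast_one]

omit [LinearOrder Λ] [Fintype Λ] in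
/-- `|ε_y| = 1` in `ℂ`. [folklore] -/
private theorem norm_stagger_cast (ε : Λ → ℤˣ) (y : Λ) : ‖((ε y : ℤ) : ℂ)‖ = 1 := by
  rcases Int.units_eq_one_or (ε y) with h | h <;> simp [h]

/-- **Pseudospin isotropy of the density–density and on-site-pair correlators.** If
`η_ε ψ = η†_ε ψ = 0` (a pseudospin singlet, e.g. THE half-filled repulsive Hubbard ground state on a
connected balanced bipartite graph), then for all `x ≠ y`
`⟨ψ, (n_x - 1)(n_y - 1) ψ⟩ = 2 ε_x ε_y ⟨ψ, c†_{x↑} c†_{x↓} c_{y↓} c_{y↑} ψ⟩`: the charge correlation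
function equals twice the staggered `s`-wave (on-site) pair correlation function — the `η`-`SU(2)`
rotation maps the charge-density-wave operator onto the `s`-wave pairing operator, so in a pseudospin
singlet the two orders are exactly degenerate. (Expectation of the key commutator
`etaRaise_commutator_chargeDev_pairAnnihilation`: its left side has zero expectation, and `ε_y² = 1`.)
[cite: Zhang1990] [cite: YangZhang1990, Theorem 1] [cite: XiangWu2022, §13.4 eqs. (13.51)–(13.52)] -/
theorem expect_chargeDev_mul_chargeDev_eq_of_eta_mulVec_eq_zero {x y : Λ} (hxy : x ≠ y) (ε : Λ → ℤˣ)
    {ψ : Fock (Orb Λ)} (hLo : etaLower ε *ᵥ ψ = 0) (hR : etaRaise ε *ᵥ ψ = 0) :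
    expect ((numberOp x 0 + numberOp x 1 - 1) * (numberOp y 0 + numberOp y 1 - 1)) ψ =
      2 * (((ε x : ℤ) : ℂ) * ((ε y : ℤ) : ℂ)) *
        expect (creation (orb x 0) * creation (orb x 1) * (annihilation (orb y 1) * annihilation (orb y 0))) ψ := by
  have key := etaRaise_commutator_chargeDev_pairAnnihilation hxy ε ψ
  rw [hR, mulVec_zero, mulVec_zero, sub_zero] at key
  have h0 := star_dotProduct_etaRaise_mulVec_eq_zero ε hLo
    ((numberOp x 0 + numberOp x 1 - 1) *ᵥ ((annihilation (orb y 1) * annihilation (orb y 0)) *ᵥ ψ))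
  rw [key, dotProduct_add, dotProduct_neg, dotProduct_smul, dotProduct_smul, mulVec_mulVec, mulVec_mulVec,
    smul_eq_mul, smul_eq_mul] at h0
  have hy := stagger_cast_mul_self ε y
  unfold expect
  linear_combination ((ε y : ℤ) : ℂ) * h0 -
    (star ψ ⬝ᵥ (((numberOp x 0 + numberOp x 1 - 1) * (numberOp y 0 + numberOp y 1 - 1)) *ᵥ ψ)) * hy

/-! ### §4 Cauchy–Schwarz ceilings by the double occupancy -/

/-- `⟨φ, Δ†_x w⟩ = ⟨Δ_x φ, w⟩` (`(c†_{x↑} c†_{x↓})ᴴ = c_{x↓} c_{x↑}`). [folklore] -/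
private theorem star_dotProduct_pairCreation_mulVec (x : Λ) (φ w : Fock (Orb Λ)) :
    star φ ⬝ᵥ ((creation (orb x 0) * creation (orb x 1)) *ᵥ w) =
      star ((annihilation (orb x 1) * annihilation (orb x 0)) *ᵥ φ) ⬝ᵥ w := by
  rw [star_mulVec, conjTranspose_mul, annihilation_conjTranspose, annihilation_conjTranspose,
    ← dotProduct_mulVec]

/-- `‖Δ_x φ‖² = Re ⟨φ, n_{x↑} n_{x↓} φ⟩` (the local double occupancy). [cite: Yang1989, eq. (4)] -/
theorem eucNorm_pairAnnihilation_mulVec_sq (x : Λ) (φ : Fock (Orb Λ)) :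
    eucNorm ((annihilation (orb x 1) * annihilation (orb x 0)) *ᵥ φ) ^ 2 =
      (expect (numberOp x 0 * numberOp x 1) φ).re := by
  rw [eucNorm_sq, ← star_dotProduct_pairCreation_mulVec, mulVec_mulVec, pairCreation_mul_pairAnnihilation_self]
  rfl

/-- `0 ≤ Re ⟨φ, n_{x↑} n_{x↓} φ⟩`. [folklore] -/
private theorem re_expect_doubleOcc_nonneg (x : Λ) (φ : Fock (Orb Λ)) :
    0 ≤ (expect (numberOp x 0 * numberOp x 1) φ).re := by
  rw [← eucNorm_pairAnnihilation_mulVec_sq]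
  positivity

/-- **On-site pair correlators are bounded by the double occupancy** (any state, any two sites):
`|⟨φ, c†_{x↑} c†_{x↓} c_{y↓} c_{y↑} φ⟩| ≤ (⟨n_{x↑} n_{x↓}⟩_φ + ⟨n_{y↑} n_{y↓}⟩_φ) / 2`
(Cauchy–Schwarz `|⟨Δ_x φ, Δ_y φ⟩| ≤ ‖Δ_x φ‖ ‖Δ_y φ‖` and `2ab ≤ a² + b²`; the elementary half of Zhang's
constraints on s-wave pairing). [cite: ZhangPRB1990] [cite: Tasaki2020, App. A.3] -/
theorem norm_expect_pairCreation_mul_pairAnnihilation_le (x y : Λ) (φ : Fock (Orb Λ)) :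
    ‖expect (creation (orb x 0) * creation (orb x 1) * (annihilation (orb y 1) * annihilation (orb y 0))) φ‖ ≤
      ((expect (numberOp x 0 * numberOp x 1) φ).re + (expect (numberOp y 0 * numberOp y 1) φ).re) / 2 := by
  have h := norm_star_dotProduct_le ((annihilation (orb x 1) * annihilation (orb x 0)) *ᵥ φ)
    ((annihilation (orb y 1) * annihilation (orb y 0)) *ᵥ φ)
  rw [← star_dotProduct_pairCreation_mulVec, mulVec_mulVec] at h
  have ha := eucNorm_pairAnnihilation_mulVec_sq x φ
  have hb := eucNorm_pairAnnihilation_mulVec_sq y φ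
  unfold expect at ha hb ⊢
  nlinarith [h, ha, hb, sq_nonneg (eucNorm ((annihilation (orb x 1) * annihilation (orb x 0)) *ᵥ φ) -
    eucNorm ((annihilation (orb y 1) * annihilation (orb y 0)) *ᵥ φ))]

/-- **Charge correlators of a pseudospin singlet are bounded by the double occupancy**: if
`η_ε ψ = η†_ε ψ = 0` then `|⟨ψ, (n_x - 1)(n_y - 1) ψ⟩| ≤ ⟨n_{x↑} n_{x↓}⟩_ψ + ⟨n_{y↑} n_{y↓}⟩_ψ` for
`x ≠ y` (isotropy identity, `|ε| = 1`, and the Cauchy–Schwarz ceiling). [cite: Zhang1990]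
[cite: YangZhang1990, Theorem 1] -/
theorem norm_expect_chargeDev_mul_chargeDev_le_of_eta_mulVec_eq_zero {x y : Λ} (hxy : x ≠ y)
    (ε : Λ → ℤˣ) {ψ : Fock (Orb Λ)} (hLo : etaLower ε *ᵥ ψ = 0) (hR : etaRaise ε *ᵥ ψ = 0) :
    ‖expect ((numberOp x 0 + numberOp x 1 - 1) * (numberOp y 0 + numberOp y 1 - 1)) ψ‖ ≤
      (expect (numberOp x 0 * numberOp x 1) ψ).re + (expect (numberOp y 0 * numberOp y 1) ψ).re := by
  rw [expect_chargeDev_mul_chargeDev_eq_of_eta_mulVec_eq_zero hxy ε hLo hR]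
  simp only [norm_mul, norm_stagger_cast, Complex.norm_ofNat, mul_one]
  have h := norm_expect_pairCreation_mul_pairAnnihilation_le x y ψ
  linarith

/-! ### §5 THE half-filled repulsive Hubbard ground state on a connected balanced bipartite graph -/

variable {G : SimpleGraph Λ} [DecidableRel G.Adj]

/-- **Charge–pair isotropy in THE half-filled ground state.** On a connected bipartite graph with
`|A| = |B|`, `t ≠ 0`, `U > 0`, every half-filled ground state `ψ` of `hamiltonian G t U` satisfies, for all
`x ≠ y` and every staggering `ε` alternating along edges,
`⟨ψ, (n_x - 1)(n_y - 1) ψ⟩ = 2 ε_x ε_y ⟨ψ, c†_{x↑} c†_{x↓} c_{y↓} c_{y↑} ψ⟩`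
(`η_ε ψ = η†_ε ψ = 0` by `eta_mulVec_eq_zero_of_isGroundState`). [cite: Zhang1990]
[cite: YangZhang1990, Theorem 1] [cite: LiebPRL1989, proof of Theorem 2]
[cite: XiangWu2022, §13.4 eqs. (13.51)–(13.52)] -/
theorem expect_chargeDev_mul_chargeDev_eq_of_isGroundState (hG : G.Connected) (A : Finset Λ)
    (hA : ∀ x y : Λ, G.Adj x y → (x ∈ A ↔ y ∉ A)) (hcard : Aᶜ.card = A.card)
    {t U : ℝ} (ht : t ≠ 0) (hU : 0 < U) (ε : Λ → ℤˣ) (hε : ∀ x y : Λ, G.Adj x y → ε x = -ε y)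
    {ψ : Fock (Orb Λ)} (hψ : IsGroundState (hamiltonian G t U) (Fintype.card Λ) ψ) {x y : Λ} (hxy : x ≠ y) :
    expect ((numberOp x 0 + numberOp x 1 - 1) * (numberOp y 0 + numberOp y 1 - 1)) ψ =
      2 * (((ε x : ℤ) : ℂ) * ((ε y : ℤ) : ℂ)) *
        expect (creation (orb x 0) * creation (orb x 1) * (annihilation (orb y 1) * annihilation (orb y 0))) ψ :=
  have hη := eta_mulVec_eq_zero_of_isGroundState hG A hA hcard ht hU ε hε hψ
  expect_chargeDev_mul_chargeDev_eq_of_eta_mulVec_eq_zero hxy ε hη.1 hη.2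

/-- Eigenvector-hypothesis form (`hN`, `hHψ` as in `HubbardHalfFilledPseudospinSinglet`) of the
charge–pair isotropy. [cite: Zhang1990] [cite: YangZhang1990, Theorem 1] -/
theorem expect_chargeDev_mul_chargeDev_eq_of_groundState (hG : G.Connected) (A : Finset Λ)
    (hA : ∀ x y : Λ, G.Adj x y → (x ∈ A ↔ y ∉ A)) (hcard : Aᶜ.card = A.card)
    {t U : ℝ} (ht : t ≠ 0) (hU : 0 < U) (ε : Λ → ℤˣ) (hε : ∀ x y : Λ, G.Adj x y → ε x = -ε y)
    {ψ : Fock (Orb Λ)} (hN : IsNParticle (Fintype.card Λ) ψ)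
    (hHψ : hamiltonian G t U *ᵥ ψ = ((groundEnergyAt G t U (Fintype.card Λ) : ℝ) : ℂ) • ψ)
    {x y : Λ} (hxy : x ≠ y) :
    expect ((numberOp x 0 + numberOp x 1 - 1) * (numberOp y 0 + numberOp y 1 - 1)) ψ =
      2 * (((ε x : ℤ) : ℂ) * ((ε y : ℤ) : ℂ)) *
        expect (creation (orb x 0) * creation (orb x 1) * (annihilation (orb y 1) * annihilation (orb y 0))) ψ :=
  expect_chargeDev_mul_chargeDev_eq_of_eta_mulVec_eq_zero hxy ε
    (etaLower_mulVec_eq_zero_of_groundState hG A hA hcard ht hU ε hε hN hHψ)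
    (etaRaise_mulVec_eq_zero_of_groundState hG A hA hcard ht hU ε hε hN hHψ)

/-- **Charge correlators of THE half-filled ground state are bounded by the double occupancy**:
`|⟨ψ, (n_x - 1)(n_y - 1) ψ⟩| ≤ ⟨n_{x↑} n_{x↓}⟩_ψ + ⟨n_{y↑} n_{y↓}⟩_ψ` for `x ≠ y`. [cite: Zhang1990]
[cite: LiebPRL1989, proof of Theorem 2] -/
theorem norm_expect_chargeDev_mul_chargeDev_le_of_isGroundState (hG : G.Connected) (A : Finset Λ)
    (hA : ∀ x y : Λ, G.Adj x y → (x ∈ A ↔ y ∉ A)) (hcard : Aᶜ.card = A.card)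
    {t U : ℝ} (ht : t ≠ 0) (hU : 0 < U) {ψ : Fock (Orb Λ)}
    (hψ : IsGroundState (hamiltonian G t U) (Fintype.card Λ) ψ) {x y : Λ} (hxy : x ≠ y) :
    ‖expect ((numberOp x 0 + numberOp x 1 - 1) * (numberOp y 0 + numberOp y 1 - 1)) ψ‖ ≤
      (expect (numberOp x 0 * numberOp x 1) ψ).re + (expect (numberOp y 0 * numberOp y 1) ψ).re := by
  -- the bipartition staggering `ε = +1` on `A`, `-1` off `A`
  classical
  set ε : Λ → ℤˣ := fun z => if z ∈ A then 1 else -1 with hεdef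
  have hε : ∀ x y : Λ, G.Adj x y → ε x = -ε y := by
    intro a b hab
    have h := hA a b hab
    by_cases ha : a ∈ A
    · have hb : b ∉ A := h.1 ha
      simp [hεdef, ha, hb]
    · have hb : b ∈ A := by
        by_contra hb
        exact ha (h.2 hb)
      simp [hεdef, ha, hb]
  have hη := eta_mulVec_eq_zero_of_isGroundState hG A hA hcard ht hU ε hε hψ
  exact norm_expect_chargeDev_mul_chargeDev_le_of_eta_mulVec_eq_zero hxy ε hη.1 hη.2

/-! ### §5b The uniform density theorem (Lieb–Loss–McCann) for `η`- and spin-singlets -/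

omit [DecidableRel G.Adj] in
/-- `N̂ ψ = N ψ` written with the site occupations: `(Σ_y (n_{y↑} + n_{y↓})) ψ = N ψ` on an `N`-particle
vector. Tasaki (2020) §9.2. [folklore] -/
private theorem sum_siteNumber_mulVec_of_isNParticle {N : ℕ} {ψ : Fock (Orb Λ)} (hN : IsNParticle N ψ) :
    (∑ y : Λ, (numberOp y 0 + numberOp y 1)) *ᵥ ψ = (N : ℂ) • ψ := by
  ext s
  rw [sum_mulVec, Finset.sum_apply, Pi.smul_apply, smul_eq_mul,
    ← EtaPairingODLRO.card_mul_apply_of_isNParticle hN, EtaPairingODLRO.card_eq_sum_orb_mem, Finset.sum_mul]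
  refine Finset.sum_congr rfl fun y _ => ?_
  rw [add_mulVec, Pi.add_apply, numberOp_mulVec_apply', numberOp_mulVec_apply', add_mul]

omit [DecidableRel G.Adj] in
/-- `(n_x - 1)² = 1 - n_x + 2 n_{x↑} n_{x↓}` as a vector identity (`n_{xσ}² = n_{xσ}`). [folklore] -/
private theorem chargeDev_mulVec_chargeDev_mulVec_self (x : Λ) (f : Fock (Orb Λ)) :
    (numberOp x 0 + numberOp x 1 - 1) *ᵥ ((numberOp x 0 + numberOp x 1 - 1) *ᵥ f) =
      f - (numberOp x 0 + numberOp x 1) *ᵥ f + (2 : ℂ) • ((numberOp x 0 * numberOp x 1) *ᵥ f) := by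
  ext s
  simp only [sub_mulVec, add_mulVec, one_mulVec, ← mulVec_mulVec, Pi.sub_apply, Pi.add_apply,
    Pi.smul_apply, numberOp_mulVec_apply', smul_eq_mul]
  split_ifs <;> ring

omit [DecidableRel G.Adj] in
/-- **Row sum rule from `η_ε ψ = 0`**: `Σ_y ε_y ⟨ψ, Δ†_x Δ_y ψ⟩ = ⟨ψ, Δ†_x η_ε ψ⟩ = 0` for every site `x`.
[cite: ZhangPRB1990] [cite: Yang1989, eq. (4)] -/
theorem sum_stagger_mul_expect_pair_eq_zero_of_etaLower {ε : Λ → ℤˣ} {ψ : Fock (Orb Λ)}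
    (hLo : etaLower ε *ᵥ ψ = 0) (x : Λ) :
    ∑ y, ((ε y : ℤ) : ℂ) * expect (creation (orb x 0) * creation (orb x 1) *
      (annihilation (orb y 1) * annihilation (orb y 0))) ψ = 0 := by
  have hη : ∑ y, ((ε y : ℤ) : ℂ) • ((annihilation (orb y 1) * annihilation (orb y 0)) *ᵥ ψ) = 0 := by
    rw [← hLo, EtaPairingODLRO.etaLower_eq_sum', sum_mulVec]
    exact Finset.sum_congr rfl fun y _ => (smul_mulVec _ _ _).symm
  have hterm : ∀ y : Λ, ((ε y : ℤ) : ℂ) * (star ψ ⬝ᵥ ((creation (orb x 0) * creation (orb x 1) *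
      (annihilation (orb y 1) * annihilation (orb y 0))) *ᵥ ψ)) =
      star ψ ⬝ᵥ ((creation (orb x 0) * creation (orb x 1)) *ᵥ
        (((ε y : ℤ) : ℂ) • ((annihilation (orb y 1) * annihilation (orb y 0)) *ᵥ ψ))) := fun y => by
    rw [mulVec_smul, dotProduct_smul, smul_eq_mul, mulVec_mulVec]
  unfold expect
  rw [Finset.sum_congr rfl fun y _ => hterm y, ← dotProduct_sum, ← mulVec_sum, hη, mulVec_zero,
    dotProduct_zero]

omit [DecidableRel G.Adj] in
/-- **Uniform density, charge part** (after Lieb–Loss–McCann): a half-filled (`N = |Λ|`) pseudospin singlet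
(`η_ε ψ = η†_ε ψ = 0`) has `⟨ψ, (n_{x↑} + n_{x↓}) ψ⟩ = ‖ψ‖²` at EVERY site `x` — density exactly one, with
no translation invariance assumed. (Sum the isotropy identity over `y ≠ x`: the off-site charge correlators
add up to `-2⟨n_{x↑}n_{x↓}⟩` by the row sum rule, the full sum `Σ_y ⟨(n_x - 1)(n_y - 1)⟩` vanishes because
`Σ_y (n_y - 1) ψ = (N - |Λ|) ψ = 0`, and `(n_x - 1)² = 1 - n_x + 2 n_{x↑} n_{x↓}`.)
[cite: LiebLossMccann1993, Theorem eq. (5)] [cite: Zhang1990] -/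
theorem expect_siteNumber_eq_norm_sq_of_eta_mulVec_eq_zero (ε : Λ → ℤˣ) {ψ : Fock (Orb Λ)}
    (hLo : etaLower ε *ᵥ ψ = 0) (hR : etaRaise ε *ᵥ ψ = 0) (hN : IsNParticle (Fintype.card Λ) ψ) (x : Λ) :
    expect (numberOp x 0 + numberOp x 1) ψ = star ψ ⬝ᵥ ψ := by
  classical
  -- the full sum vanishes
  have hvec : ∑ y : Λ, ((numberOp y 0 + numberOp y 1 - 1) *ᵥ ψ) = 0 := by
    have h := sum_siteNumber_mulVec_of_isNParticle hN
    rw [sum_mulVec] at h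
    simp_rw [sub_mulVec, one_mulVec]
    rw [Finset.sum_sub_distrib, h, Finset.sum_const, Finset.card_univ, ← Nat.cast_smul_eq_nsmul ℂ, sub_self]
  have hsum0 : ∑ y : Λ, expect ((numberOp x 0 + numberOp x 1 - 1) * (numberOp y 0 + numberOp y 1 - 1)) ψ = 0 := by
    unfold expect
    simp_rw [← mulVec_mulVec]
    rw [← dotProduct_sum, ← mulVec_sum, hvec, mulVec_zero, dotProduct_zero]
  -- split off the diagonal term
  rw [← Finset.add_sum_erase _ _ (Finset.mem_univ x)] at hsum0
  -- the off-diagonal terms: isotropy + row sum rule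
  have hoff : ∑ y ∈ univ.erase x, expect ((numberOp x 0 + numberOp x 1 - 1) *
      (numberOp y 0 + numberOp y 1 - 1)) ψ = -2 * expect (numberOp x 0 * numberOp x 1) ψ := by
    have hrow := sum_stagger_mul_expect_pair_eq_zero_of_etaLower hLo x
    rw [← Finset.add_sum_erase _ _ (Finset.mem_univ x), pairCreation_mul_pairAnnihilation_self] at hrow
    rw [Finset.sum_congr rfl fun y hy =>
      expect_chargeDev_mul_chargeDev_eq_of_eta_mulVec_eq_zero (Finset.ne_of_mem_erase hy).symm ε hLo hR]
    have hfac : ∑ y ∈ univ.erase x, 2 * (((ε x : ℤ) : ℂ) * ((ε y : ℤ) : ℂ)) *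
        expect (creation (orb x 0) * creation (orb x 1) * (annihilation (orb y 1) * annihilation (orb y 0))) ψ =
        2 * ((ε x : ℤ) : ℂ) * ∑ y ∈ univ.erase x, ((ε y : ℤ) : ℂ) *
          expect (creation (orb x 0) * creation (orb x 1) * (annihilation (orb y 1) * annihilation (orb y 0))) ψ := by
      rw [Finset.mul_sum]
      exact Finset.sum_congr rfl fun y _ => by ring
    rw [hfac, eq_neg_of_add_eq_zero_right hrow]
    have hx := stagger_cast_mul_self ε x
    linear_combination (-2 * expect (numberOp x 0 * numberOp x 1) ψ) * hx
  -- the diagonal term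
  have hdiag : expect ((numberOp x 0 + numberOp x 1 - 1) * (numberOp x 0 + numberOp x 1 - 1)) ψ =
      star ψ ⬝ᵥ ψ - expect (numberOp x 0 + numberOp x 1) ψ + 2 * expect (numberOp x 0 * numberOp x 1) ψ := by
    unfold expect
    rw [← mulVec_mulVec, chargeDev_mulVec_chargeDev_mulVec_self, dotProduct_add, dotProduct_sub, dotProduct_smul,
      smul_eq_mul]
  rw [hoff, hdiag] at hsum0
  linear_combination -hsum0

omit [DecidableRel G.Adj] in
/-- **Uniform density, spin part**: a total-spin singlet (`S⁺ ψ = S⁻ ψ = 0`) has `⟨n_{x↑}⟩ = ⟨n_{x↓}⟩` at every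
site (`2 S^z_x = [S⁺_x, S⁻]` has zero expectation). [cite: LiebLossMccann1993, Theorem eq. (5)]
[cite: EsslerEtAl2005, §2.2.5 eqs. (2.71)–(2.73)] -/
theorem expect_numberOp_up_eq_down_of_spin_singlet {ψ : Fock (Orb Λ)} (hP : spinPlus *ᵥ ψ = 0)
    (hM : spinMinus *ᵥ ψ = 0) (x : Λ) : expect (numberOp x 0) ψ = expect (numberOp x 1) ψ := by
  have h := congrArg (fun A : Matrix (Finset (Orb Λ)) (Finset (Orb Λ)) ℂ => star ψ ⬝ᵥ (A *ᵥ ψ))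
    (fermionSpinPlus_mul_spinMinus_sub x)
  have h1 : star ψ ⬝ᵥ ((spinMinus * fermionSpinPlus x) *ᵥ ψ) = 0 := by
    rw [← mulVec_mulVec, spinMinus, dotProduct_mulVec, ← star_mulVec, hP, star_zero, zero_dotProduct]
  rw [sub_mulVec, dotProduct_sub, h1, sub_zero, ← mulVec_mulVec, hM, mulVec_zero, dotProduct_zero,
    Matrix.smul_mulVec, dotProduct_smul, smul_eq_mul] at h
  have h2 : star ψ ⬝ᵥ (fermionSpinZ x *ᵥ ψ) = 0 := by
    have := h.symm
    simpa using this
  rw [show fermionSpinZ x = (1 / 2 : ℂ) • (numberOp x 0 - numberOp x 1) from rfl, Matrix.smul_mulVec,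
    dotProduct_smul, smul_eq_mul, sub_mulVec, dotProduct_sub] at h2
  unfold expect
  have h3 : star ψ ⬝ᵥ (numberOp x 0 *ᵥ ψ) - star ψ ⬝ᵥ (numberOp x 1 *ᵥ ψ) = 0 := by
    have := h2; simpa using this
  exact sub_eq_zero.1 h3

/-- **Uniform density theorem for THE half-filled repulsive ground state** (Lieb–Loss–McCann): on a
connected bipartite graph with `|A| = |B|`, `t ≠ 0`, `U > 0`, every half-filled ground state `ψ` of
`hamiltonian G t U` has `⟨ψ, n_{xσ} ψ⟩ = ½ ‖ψ‖²` for every site `x` and spin `σ` — the charge part from the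
pseudospin singlet property (`expect_siteNumber_eq_norm_sq_of_eta_mulVec_eq_zero`), the spin part from
Lieb's `S = 0` (`LiebHalfFilled.finrank_groundSector_eq_one`). [cite: LiebLossMccann1993, Theorem eq. (5)]
[cite: LiebPRL1989, Theorem 2] -/
theorem expect_numberOp_eq_half_of_groundState (hG : G.Connected) (A : Finset Λ)
    (hA : ∀ x y : Λ, G.Adj x y → (x ∈ A ↔ y ∉ A)) (hcard : Aᶜ.card = A.card)
    {t U : ℝ} (ht : t ≠ 0) (hU : 0 < U) {ψ : Fock (Orb Λ)} (hN : IsNParticle (Fintype.card Λ) ψ)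
    (hHψ : hamiltonian G t U *ᵥ ψ = ((groundEnergyAt G t U (Fintype.card Λ) : ℝ) : ℂ) • ψ)
    (x : Λ) (σ : Fin 2) : expect (numberOp x σ) ψ = (1 / 2 : ℂ) * (star ψ ⬝ᵥ ψ) := by
  classical
  -- pseudospin singlet (bipartition staggering) ⇒ charge part
  set ε : Λ → ℤˣ := fun z => if z ∈ A then 1 else -1 with hεdef
  have hε : ∀ x y : Λ, G.Adj x y → ε x = -ε y := by
    intro a b hab
    have h := hA a b hab
    by_cases ha : a ∈ A
    · have hb : b ∉ A := h.1 ha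
      simp [hεdef, ha, hb]
    · have hb : b ∈ A := by
        by_contra hb
        exact ha (h.2 hb)
      simp [hεdef, ha, hb]
  have hcharge := expect_siteNumber_eq_norm_sq_of_eta_mulVec_eq_zero ε
    (etaLower_mulVec_eq_zero_of_groundState hG A hA hcard ht hU ε hε hN hHψ)
    (etaRaise_mulVec_eq_zero_of_groundState hG A hA hcard ht hU ε hε hN hHψ) hN x
  -- spin singlet ⇒ spin part
  have hmem : ψ ∈ (hamiltonian G t U).sectorGroundSpace (nParticleSubmodule (ι := Orb Λ) (Fintype.card Λ)) :=
    (LiebHalfFilled.mem_groundSector_iff G t U _ ψ).2 ⟨hN, hHψ⟩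
  have hS := (LiebHalfFilled.finrank_groundSector_eq_one hG A hA hcard ht hU).2 ψ hmem
  obtain ⟨hP, hM, -⟩ := spin_mulVec_eq_zero_of_spinSq_mulVec_eq_zero hS
  have hspin := expect_numberOp_up_eq_down_of_spin_singlet hP hM x
  have hsum : expect (numberOp x 0) ψ + expect (numberOp x 1) ψ = star ψ ⬝ᵥ ψ := by
    rw [← hcharge]; unfold expect; rw [add_mulVec, dotProduct_add]
  fin_cases σ
  · show expect (numberOp x 0) ψ = _
    linear_combination (hsum + hspin) / 2
  · show expect (numberOp x 1) ψ = _
    linear_combination (hsum + hspin.symm) / 2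

/-- `IsGroundState` form of the uniform density theorem. [cite: LiebLossMccann1993, Theorem eq. (5)] -/
theorem expect_numberOp_eq_half_of_isGroundState (hG : G.Connected) (A : Finset Λ)
    (hA : ∀ x y : Λ, G.Adj x y → (x ∈ A ↔ y ∉ A)) (hcard : Aᶜ.card = A.card)
    {t U : ℝ} (ht : t ≠ 0) (hU : 0 < U) {ψ : Fock (Orb Λ)}
    (hψ : IsGroundState (hamiltonian G t U) (Fintype.card Λ) ψ) (x : Λ) (σ : Fin 2) :
    expect (numberOp x σ) ψ = (1 / 2 : ℂ) * (star ψ ⬝ᵥ ψ) :=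
  expect_numberOp_eq_half_of_groundState hG A hA hcard ht hU hψ.1 hψ.2.2 x σ

omit [DecidableRel G.Adj] in
/-- `⟨n_x n_y⟩ = ⟨(n_x - 1)(n_y - 1)⟩ + ⟨n_x⟩ + ⟨n_y⟩ - ‖φ‖²` (`n_x = n_{x↑} + n_{x↓}`), for every vector:
the density–density correlator in terms of the charge-deviation correlator. [folklore] -/
private theorem expect_siteNumber_mul_siteNumber_eq (x y : Λ) (φ : Fock (Orb Λ)) :
    expect ((numberOp x 0 + numberOp x 1) * (numberOp y 0 + numberOp y 1)) φ =
      expect ((numberOp x 0 + numberOp x 1 - 1) * (numberOp y 0 + numberOp y 1 - 1)) φ +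
        expect (numberOp x 0 + numberOp x 1) φ + expect (numberOp y 0 + numberOp y 1) φ - star φ ⬝ᵥ φ := by
  unfold expect
  simp only [sub_mul, mul_sub, mul_one, one_mul, sub_mulVec, one_mulVec, dotProduct_sub]
  ring

/-- **Connected density–density correlator of THE half-filled ground state** (`x ≠ y`):
`⟨ψ, n_x n_y ψ⟩ - ‖ψ‖² = 2 ε_x ε_y ⟨ψ, Δ†_x Δ_y ψ⟩` — by uniform density `⟨n_x⟩ = ⟨n_y⟩ = ‖ψ‖²`, so for
`‖ψ‖ = 1` the left side is `⟨n_x n_y⟩ - ⟨n_x⟩⟨n_y⟩`. [cite: Zhang1990] [cite: LiebLossMccann1993, Theorem eq. (5)] -/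
theorem expect_siteNumber_mul_siteNumber_sub_eq_of_groundState (hG : G.Connected) (A : Finset Λ)
    (hA : ∀ x y : Λ, G.Adj x y → (x ∈ A ↔ y ∉ A)) (hcard : Aᶜ.card = A.card)
    {t U : ℝ} (ht : t ≠ 0) (hU : 0 < U) (ε : Λ → ℤˣ) (hε : ∀ x y : Λ, G.Adj x y → ε x = -ε y)
    {ψ : Fock (Orb Λ)} (hN : IsNParticle (Fintype.card Λ) ψ)
    (hHψ : hamiltonian G t U *ᵥ ψ = ((groundEnergyAt G t U (Fintype.card Λ) : ℝ) : ℂ) • ψ)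
    {x y : Λ} (hxy : x ≠ y) :
    expect ((numberOp x 0 + numberOp x 1) * (numberOp y 0 + numberOp y 1)) ψ - star ψ ⬝ᵥ ψ =
      2 * (((ε x : ℤ) : ℂ) * ((ε y : ℤ) : ℂ)) *
        expect (creation (orb x 0) * creation (orb x 1) * (annihilation (orb y 1) * annihilation (orb y 0))) ψ := by
  have hLo := etaLower_mulVec_eq_zero_of_groundState hG A hA hcard ht hU ε hε hN hHψ
  have hR := etaRaise_mulVec_eq_zero_of_groundState hG A hA hcard ht hU ε hε hN hHψ
  rw [expect_siteNumber_mul_siteNumber_eq, expect_chargeDev_mul_chargeDev_eq_of_eta_mulVec_eq_zero hxy ε hLo hR,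
    expect_siteNumber_eq_norm_sq_of_eta_mulVec_eq_zero ε hLo hR hN x,
    expect_siteNumber_eq_norm_sq_of_eta_mulVec_eq_zero ε hLo hR hN y]
  ring

end General

/-! ### §6 The even square torus: translation-averaged rows -/

section Torus

variable {d L : ℕ} [NeZero L]

omit [NeZero L] in
/-- **`ε_x ε_{x+r} = ε_r` on a torus of even side** (`ε_x = (-1)^{Σ_i x_i}` on representatives; reduction
mod the even `L` does not change parities). Lieb, PRL 62 (1989) 1201 (bipartite hypercubic tori). [folklore] -/
private theorem torusStagger_mul_torusStagger_add (hL : Even L) (x r : FermionTorus d L) :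
    torusStagger x * torusStagger (x + r) = torusStagger r := by
  have h2 : (2 : ℕ) ∣ L := even_iff_two_dvd.mp hL
  have hmod : (∑ i, (ofLex (x + r) i : ℕ)) % 2 = (∑ i, (ofLex x i : ℕ) + ∑ i, (ofLex r i : ℕ)) % 2 := by
    calc (∑ i, (ofLex (x + r) i : ℕ)) % 2
        = (∑ i, ((ofLex x i : ℕ) + (ofLex r i : ℕ)) % L) % 2 :=
          congrArg (· % 2) (Finset.sum_congr rfl fun i _ => Fin.val_add _ _)
      _ = (∑ i, ((ofLex x i : ℕ) + (ofLex r i : ℕ)) % L % 2) % 2 := Finset.sum_nat_mod _ _ _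
      _ = (∑ i, ((ofLex x i : ℕ) + (ofLex r i : ℕ)) % 2) % 2 :=
          congrArg (· % 2) (Finset.sum_congr rfl fun i _ => Nat.mod_mod_of_dvd _ h2)
      _ = (∑ i, ((ofLex x i : ℕ) + (ofLex r i : ℕ))) % 2 := (Finset.sum_nat_mod _ _ _).symm
      _ = (∑ i, (ofLex x i : ℕ) + ∑ i, (ofLex r i : ℕ)) % 2 := by rw [Finset.sum_add_distrib]
  have hkey : (∑ i, (ofLex x i : ℕ) + ∑ i, (ofLex (x + r) i : ℕ)) % 2 = (∑ i, (ofLex r i : ℕ)) % 2 := by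
    omega
  -- `u ^ n = u ^ (n % 2)` for the power operation `Int.instUnitsPow` that `torusStagger` elaborates to
  -- (definitionally the monoid power)
  have hpow : ∀ (u : ℤˣ) (n : ℕ), u ^ n = u ^ (n % 2) := fun u n => Int.units_pow_eq_pow_mod_two u n
  rw [torusStagger_apply, torusStagger_apply, torusStagger_apply, ← uzpow_add, hpow, hkey, ← hpow]

omit [NeZero L] in
/-- The same in `ℂ`: `ε_x ε_{x+r} = ε_r`. [folklore] -/
private theorem torusStagger_cast_mul_cast_add (hL : Even L) (x r : FermionTorus d L) :
    ((torusStagger x : ℤ) : ℂ) * ((torusStagger (x + r) : ℤ) : ℂ) = ((torusStagger r : ℤ) : ℂ) := by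
  rw [← Int.cast_mul, ← Units.val_mul, torusStagger_mul_torusStagger_add hL]

/-- **The translation-summed on-site pair correlator is bounded by the total double occupancy** (any
state, any displacement `r`, any torus): `|Σ_x ⟨φ, c†_{x↑} c†_{x↓} c_{x+r,↓} c_{x+r,↑} φ⟩| ≤ Re ⟨φ, Σ_x n_{x↑} n_{x↓} φ⟩`
(term by term `≤ (⟨D_x⟩ + ⟨D_{x+r}⟩)/2` and `x ↦ x + r` is a bijection). [cite: ZhangPRB1990] -/
theorem norm_sum_expect_pair_translate_le (r : FermionTorus d L) (φ : Fock (Orb (FermionTorus d L))) :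
    ‖∑ x : FermionTorus d L, expect (creation (orb x 0) * creation (orb x 1) *
        (annihilation (orb (x + r) 1) * annihilation (orb (x + r) 0))) φ‖ ≤
      (expect (∑ x : FermionTorus d L, numberOp x 0 * numberOp x 1) φ).re := by
  have hshift : ∑ x : FermionTorus d L, (expect (numberOp (x + r) 0 * numberOp (x + r) 1) φ).re =
      ∑ x : FermionTorus d L, (expect (numberOp x 0 * numberOp x 1) φ).re :=
    Fintype.sum_equiv (Equiv.addRight r) _ _ fun x => rfl
  have hD : (expect (∑ x : FermionTorus d L, numberOp x 0 * numberOp x 1) φ).re =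
      ∑ x : FermionTorus d L, (expect (numberOp x 0 * numberOp x 1) φ).re := by
    unfold expect
    rw [sum_mulVec, dotProduct_sum, Complex.re_sum]
  refine (norm_sum_le _ _).trans ?_
  calc ∑ x : FermionTorus d L, ‖expect (creation (orb x 0) * creation (orb x 1) *
          (annihilation (orb (x + r) 1) * annihilation (orb (x + r) 0))) φ‖
      ≤ ∑ x : FermionTorus d L, ((expect (numberOp x 0 * numberOp x 1) φ).re +
          (expect (numberOp (x + r) 0 * numberOp (x + r) 1) φ).re) / 2 :=
        Finset.sum_le_sum fun x _ => norm_expect_pairCreation_mul_pairAnnihilation_le x (x + r) φ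
    _ = (expect (∑ x : FermionTorus d L, numberOp x 0 * numberOp x 1) φ).re := by
        rw [← Finset.sum_div, Finset.sum_add_distrib, hshift, hD]
        ring

/-- **Charge–pair isotropy on the even square torus**, pointwise: every half-filled ground state `ψ` of
`hamiltonian (fermionTorusGraph 2 L) t U` (`L` even, `t ≠ 0`, `U > 0`) has, for all `x ≠ y`,
`⟨ψ, (n_x - 1)(n_y - 1) ψ⟩ = 2 (-1)^{x+y} ⟨ψ, c†_{x↑} c†_{x↓} c_{y↓} c_{y↑} ψ⟩`. [cite: Zhang1990]
[cite: YangZhang1990, Theorem 1] [cite: LiebPRL1989, proof of Theorem 2] -/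
theorem hubbardTorus_expect_chargeDev_mul_chargeDev_eq (hL : Even L) {t U : ℝ} (ht : t ≠ 0) (hU : 0 < U)
    {ψ : Fock (Orb (FermionTorus 2 L))} (hψ : IsGroundState (hamiltonian (fermionTorusGraph 2 L) t U) (L ^ 2) ψ)
    {x y : FermionTorus 2 L} (hxy : x ≠ y) :
    expect ((numberOp x 0 + numberOp x 1 - 1) * (numberOp y 0 + numberOp y 1 - 1)) ψ =
      2 * (((torusStagger x : ℤ) : ℂ) * ((torusStagger y : ℤ) : ℂ)) *
        expect (creation (orb x 0) * creation (orb x 1) * (annihilation (orb y 1) * annihilation (orb y 0))) ψ := by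
  obtain ⟨hLo, hR⟩ := (hubbardTorus_eta_mulVec_eq_zero_of_isGroundState hL ht hU hψ).1
  -- (`convert`: the `DecidableEq` instances behind `1 : Matrix _ _ ℂ` on the torus and in the general
  -- lemma are found along different paths; they agree by `Subsingleton.elim`)
  convert expect_chargeDev_mul_chargeDev_eq_of_eta_mulVec_eq_zero hxy (torusStagger (d := 2) (L := L)) hLo hR

/-- **Pointwise ceiling on the torus**: `|⟨ψ, (n_x - 1)(n_y - 1) ψ⟩| ≤ ⟨n_{x↑} n_{x↓}⟩_ψ + ⟨n_{y↑} n_{y↓}⟩_ψ`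
for `x ≠ y` in every half-filled ground state (`L` even, `t ≠ 0`, `U > 0`). [cite: Zhang1990]
[cite: LiebPRL1989, proof of Theorem 2] -/
theorem hubbardTorus_norm_expect_chargeDev_mul_chargeDev_le (hL : Even L) {t U : ℝ} (ht : t ≠ 0)
    (hU : 0 < U) {ψ : Fock (Orb (FermionTorus 2 L))}
    (hψ : IsGroundState (hamiltonian (fermionTorusGraph 2 L) t U) (L ^ 2) ψ)
    {x y : FermionTorus 2 L} (hxy : x ≠ y) :
    ‖expect ((numberOp x 0 + numberOp x 1 - 1) * (numberOp y 0 + numberOp y 1 - 1)) ψ‖ ≤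
      (expect (numberOp x 0 * numberOp x 1) ψ).re + (expect (numberOp y 0 * numberOp y 1) ψ).re := by
  obtain ⟨hLo, hR⟩ := (hubbardTorus_eta_mulVec_eq_zero_of_isGroundState hL ht hU hψ).1
  convert norm_expect_chargeDev_mul_chargeDev_le_of_eta_mulVec_eq_zero hxy (torusStagger (d := 2) (L := L))
    hLo hR

/-- **Translation-summed charge–pair isotropy on the even square torus**: for every displacement `r ≠ 0`,
`Σ_x ⟨ψ, (n_x - 1)(n_{x+r} - 1) ψ⟩ = 2 ε_r Σ_x ⟨ψ, c†_{x↑} c†_{x↓} c_{x+r,↓} c_{x+r,↑} ψ⟩`,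
`ε_r = (-1)^{r₁+r₂}`: the charge structure factor at `q` equals (up to the on-site term) twice the `s`-wave
pair structure factor at `q + (π,π)`. [cite: Zhang1990] [cite: ZhangPRB1990] [cite: YangZhang1990, Theorem 1]
[cite: XiangWu2022, §13.4 eqs. (13.51)–(13.52)] -/
theorem hubbardTorus_sum_expect_chargeDev_translate_eq (hL : Even L) {t U : ℝ} (ht : t ≠ 0) (hU : 0 < U)
    {ψ : Fock (Orb (FermionTorus 2 L))} (hψ : IsGroundState (hamiltonian (fermionTorusGraph 2 L) t U) (L ^ 2) ψ)
    {r : FermionTorus 2 L} (hr : r ≠ 0) :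
    ∑ x : FermionTorus 2 L, expect ((numberOp x 0 + numberOp x 1 - 1) *
        (numberOp (x + r) 0 + numberOp (x + r) 1 - 1)) ψ =
      2 * ((torusStagger r : ℤ) : ℂ) * ∑ x : FermionTorus 2 L, expect (creation (orb x 0) * creation (orb x 1) *
        (annihilation (orb (x + r) 1) * annihilation (orb (x + r) 0))) ψ := by
  rw [Finset.mul_sum]
  refine Finset.sum_congr rfl fun x _ => ?_
  have hx : x ≠ x + r := fun h => hr (left_eq_add.mp h)
  rw [hubbardTorus_expect_chargeDev_mul_chargeDev_eq hL ht hU hψ hx, torusStagger_cast_mul_cast_add hL]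

/-- **Translation-summed ceilings on the even square torus** for every half-filled ground state
(`L` even, `t ≠ 0`, `U > 0`) and every displacement `r ≠ 0`:
`|Σ_x ⟨Δ†_x Δ_{x+r}⟩| ≤ ⟨D̂⟩` and `|Σ_x ⟨(n_x - 1)(n_{x+r} - 1)⟩| ≤ 2 ⟨D̂⟩`, `D̂ = Σ_x n_{x↑} n_{x↓}` — so a
certified two-sided bracket on the double occupancy is at once a certified ceiling on the on-site pair and
charge correlation functions at every fixed distance. [cite: Zhang1990] [cite: LiebPRL1989, proof of Theorem 2] -/
theorem hubbardTorus_norm_sum_expect_chargeDev_translate_le (hL : Even L) {t U : ℝ} (ht : t ≠ 0)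
    (hU : 0 < U) {ψ : Fock (Orb (FermionTorus 2 L))}
    (hψ : IsGroundState (hamiltonian (fermionTorusGraph 2 L) t U) (L ^ 2) ψ) {r : FermionTorus 2 L}
    (hr : r ≠ 0) :
    ‖∑ x : FermionTorus 2 L, expect (creation (orb x 0) * creation (orb x 1) *
          (annihilation (orb (x + r) 1) * annihilation (orb (x + r) 0))) ψ‖ ≤
        (expect (∑ x : FermionTorus 2 L, numberOp x 0 * numberOp x 1) ψ).re ∧
      ‖∑ x : FermionTorus 2 L, expect ((numberOp x 0 + numberOp x 1 - 1) *
          (numberOp (x + r) 0 + numberOp (x + r) 1 - 1)) ψ‖ ≤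
        2 * (expect (∑ x : FermionTorus 2 L, numberOp x 0 * numberOp x 1) ψ).re := by
  have h1 := norm_sum_expect_pair_translate_le r ψ
  refine ⟨h1, ?_⟩
  rw [hubbardTorus_sum_expect_chargeDev_translate_eq hL ht hU hψ hr, norm_mul, norm_mul, Complex.norm_ofNat]
  have hε : ‖((torusStagger r : ℤ) : ℂ)‖ = 1 := by
    rcases Int.units_eq_one_or (torusStagger r) with h | h <;> simp [h]
  rw [hε, mul_one]
  linarith

/-- **Uniform density theorem on the even square torus** (Lieb–Loss–McCann): every half-filled ground state
of the repulsive Hubbard model on `(ℤ/Lℤ)²`, `L` even, `t ≠ 0`, `U > 0`, has `⟨ψ, n_{xσ} ψ⟩ = ½ ‖ψ‖²` at every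
site and spin. [cite: LiebLossMccann1993, Theorem eq. (5)] [cite: LiebPRL1989, Theorem 2] -/
theorem hubbardTorus_expect_numberOp_eq_half (hL : Even L) {t U : ℝ} (ht : t ≠ 0) (hU : 0 < U)
    {ψ : Fock (Orb (FermionTorus 2 L))} (hψ : IsGroundState (hamiltonian (fermionTorusGraph 2 L) t U) (L ^ 2) ψ)
    (x : FermionTorus 2 L) (σ : Fin 2) : expect (numberOp x σ) ψ = (1 / 2 : ℂ) * (star ψ ⬝ᵥ ψ) := by
  obtain ⟨hG, hA, h2, -⟩ := LiebHalfFilled.hubbardTorus_lieb_hypotheses (L := L) hL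
  have hcard := LiebHalfFilled.compl_card_eq_card_of_two_mul h2
  obtain ⟨hN, -, hHψ⟩ := hψ
  have hc : Fintype.card (FermionTorus 2 L) = L ^ 2 := by
    simp only [FermionTorus, Fintype.card_lex, Fintype.card_fun, Fintype.card_fin]
  rw [← hc] at hN hHψ
  exact expect_numberOp_eq_half_of_groundState hG _ hA hcard ht hU hN hHψ x σ

/-- **Density one on the torus**: `⟨ψ, (n_{x↑} + n_{x↓}) ψ⟩ = ‖ψ‖²` at every site of the even square torus in every
half-filled ground state. [cite: LiebLossMccann1993, Theorem eq. (5)] -/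
theorem hubbardTorus_expect_siteNumber_eq (hL : Even L) {t U : ℝ} (ht : t ≠ 0) (hU : 0 < U)
    {ψ : Fock (Orb (FermionTorus 2 L))} (hψ : IsGroundState (hamiltonian (fermionTorusGraph 2 L) t U) (L ^ 2) ψ)
    (x : FermionTorus 2 L) : expect (numberOp x 0 + numberOp x 1) ψ = star ψ ⬝ᵥ ψ := by
  have h0 := hubbardTorus_expect_numberOp_eq_half hL ht hU hψ x 0
  have h1 := hubbardTorus_expect_numberOp_eq_half hL ht hU hψ x 1
  unfold expect at h0 h1 ⊢
  rw [add_mulVec, dotProduct_add, h0, h1]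
  ring

/-- **Translation-summed density–density correlator on the even square torus** (`r ≠ 0`):
`Σ_x ⟨ψ, n_x n_{x+r} ψ⟩ - L² ‖ψ‖² = 2 ε_r Σ_x ⟨ψ, Δ†_x Δ_{x+r} ψ⟩` in every half-filled ground state, hence
`|Σ_x ⟨n_x n_{x+r}⟩ - L² ‖ψ‖²| ≤ 2 Re ⟨ψ, D̂ ψ⟩`: the connected density correlation at every fixed distance is
bounded by twice the double occupancy. [cite: Zhang1990] [cite: LiebLossMccann1993, Theorem eq. (5)] -/
theorem hubbardTorus_sum_expect_siteNumber_translate (hL : Even L) {t U : ℝ} (ht : t ≠ 0) (hU : 0 < U)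
    {ψ : Fock (Orb (FermionTorus 2 L))} (hψ : IsGroundState (hamiltonian (fermionTorusGraph 2 L) t U) (L ^ 2) ψ)
    {r : FermionTorus 2 L} (hr : r ≠ 0) :
    ∑ x : FermionTorus 2 L, expect ((numberOp x 0 + numberOp x 1) * (numberOp (x + r) 0 + numberOp (x + r) 1)) ψ -
        (Fintype.card (FermionTorus 2 L) : ℂ) * (star ψ ⬝ᵥ ψ) =
      2 * ((torusStagger r : ℤ) : ℂ) * ∑ x : FermionTorus 2 L,
        expect (creation (orb x 0) * creation (orb x 1) *
          (annihilation (orb (x + r) 1) * annihilation (orb (x + r) 0))) ψ ∧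
    ‖∑ x : FermionTorus 2 L, expect ((numberOp x 0 + numberOp x 1) * (numberOp (x + r) 0 + numberOp (x + r) 1)) ψ -
        (Fintype.card (FermionTorus 2 L) : ℂ) * (star ψ ⬝ᵥ ψ)‖ ≤
      2 * (expect (∑ x : FermionTorus 2 L, numberOp x 0 * numberOp x 1) ψ).re := by
  have hid : ∑ x : FermionTorus 2 L, expect ((numberOp x 0 + numberOp x 1) *
      (numberOp (x + r) 0 + numberOp (x + r) 1)) ψ - (Fintype.card (FermionTorus 2 L) : ℂ) * (star ψ ⬝ᵥ ψ) =
      ∑ x : FermionTorus 2 L, expect ((numberOp x 0 + numberOp x 1 - 1) *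
        (numberOp (x + r) 0 + numberOp (x + r) 1 - 1)) ψ := by
    -- (pointwise identity proved in place, so that the `1 : Matrix _ _ ℂ` instances agree syntactically)
    have hs := hubbardTorus_expect_siteNumber_eq hL ht hU hψ
    have hpt : ∀ x : FermionTorus 2 L,
        expect ((numberOp x 0 + numberOp x 1) * (numberOp (x + r) 0 + numberOp (x + r) 1)) ψ =
          expect ((numberOp x 0 + numberOp x 1 - 1) * (numberOp (x + r) 0 + numberOp (x + r) 1 - 1)) ψ +
            star ψ ⬝ᵥ ψ := by
      intro x
      have hx := hs x
      have hxr := hs (x + r)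
      unfold expect at hx hxr ⊢
      simp only [sub_mul, mul_sub, mul_one, one_mul, sub_mulVec, one_mulVec, dotProduct_sub]
      rw [hx, hxr]
      ring
    rw [Finset.sum_congr rfl fun x _ => hpt x, Finset.sum_add_distrib, Finset.sum_const, Finset.card_univ,
      nsmul_eq_mul]
    ring
  rw [hid]
  exact ⟨hubbardTorus_sum_expect_chargeDev_translate_eq hL ht hU hψ hr,
    (hubbardTorus_norm_sum_expect_chargeDev_translate_le hL ht hU hψ hr).2⟩

end Torus

end Literature.MathematicalPhysics.QuantumLattice
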